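import Summits.QuantumFields.YangMills.Theorems.IR.LevelwiseDominationTower
import Summits.QuantumFields.YangMills.Theorems.IR.RunningLandmarkDefs
import Summits.QuantumFields.YangMills.Theorems.BalabanLadderIRRankPurityCofinalDefs
import Summits.QuantumFields.YangMills.Theorems.BalabanLadderIRPinnedExitCofinal
import Summits.QuantumFields.YangMills.Theorems.BalabanLadderIRColdPurityBridgeRungs
import Summits.QuantumFields.YangMills.Theses.BalabanLadder
import HarnessLib

/-!
# Crux `IRcof` (stmt-QuantumFields-26930) — supplier line «lipschitz-vacuum-transport», part 3: LEMMA B (a level matching dominates every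
# trace) and the KERNEL-CLEAN ARROWS `LW-DOM ⇒ PXcof(1∕24)`, `PXcof(1∕24) ⇒ N_cof ⇒ IRcof`, `LW-DOM ⇒ N_cof ⇒ IRcof` BY NAME

Helper module for `Summit.QuantumFields.YangMills.Theses.BalabanLadder.IRcof` (`--supports stmt-QuantumFields-26930`; closes nothing), landed by
the crux LEAD ymfull-r2c-lead-1 g1 (`Cruxes/IRcof/PICKED.md`).  Proofs of B1/B and of `pinnedExitsCofinal_of_levelwise` are byte-identical to
the critic-certified bytes c2701ff81c6bc899 (§2–§3; crit-1 CUT-3(B2) PASS, axioms std); new here: the (v)/BC5-side negative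
`not_levelMatched_of_two_tops` (two ratio levels at the top value admit no level matching into a tower of positive mass — degenerate flux
vacua kill LW-DOM-shaped statements, which is why LW-DOM is typed for simply-connected `G`), the slot's bill over the Theorems copy of PXcof
`IRcof_of_pinnedExitsCofinalAt : RunningLandmark.PinnedExitsCofinalAt (1/24) → IRnscCof → IRcof` (the composition `PinnedCofinalBill.IRcof_of`
of the registered skeleton d3255819134117aa, importable), and the supplier arrow `IRcof_of_levelwise : LevelwiseDominatedCofinal → IRnscCof →
IRcof`.  So a proof of `LevelwiseDominatedCofinal` closes the registered stub `stub_pinnedExitsCofinal` by `pinnedExitsCofinal_of_levelwise`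
(one line) — the supplier relation recorded in `PICKED.md` is now a tree theorem.

HONEST FRAMING: supplier-line bookkeeping for a CONDITIONAL reduction of the junior binder `IRcof` (the infinite-volume rung R2c of a
conditional chain); `LevelwiseDominatedCofinal` is an OPEN, width-0 line statement (it contains the volume-uniform lattice mass gap); nothing
here proves it, `PinnedExitsCofinalAt (1/24)`, `IRnscCof`, `IRcof`, `IR`, any leg, or the Yang–Mills mass gap (Clay) — NOT proved; NOT
continuum ∕ OS.  R4 closes only the conditional finite-𝕋⁴ rung `BalabanLadder.UV`.
-/

set_option autoImplicit false

noncomputable section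

open Filter Topology MeasureTheory
open scoped BigOperators
open Literature.MathematicalPhysics.QuantumFieldTheory Literature.MathematicalPhysics.QuantumLattice
open Summit.QuantumFields.YangMills.Cruxes.OSLegsFromFemtoAndGap.DlrCollarTransfer (LowerBounds)
open Summit.QuantumFields.YangMills.Cruxes.IR.RankPurity (IsRatioDatum)
open Summit.QuantumFields.YangMills.Cruxes.IR.ColdPurityBridge (coldDefect one_sub_ratio_le_two_mul_traceExcess)
open Summit.QuantumFields.YangMills.Cruxes.IR.RankPurity (exists_ratioDatum IRnscCof)
open Summit.QuantumFields.YangMills.Cruxes.IRcof.RunningLandmark (PinnedExitsCofinalAt)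
open Summit.QuantumFields.YangMills.Cruxes.IR.PinnedExitCofinal (cofinalGapOn_of_pinnedExits)

namespace Summit.QuantumFields.YangMills.Cruxes.IR.LevelwiseDomination

/-! ## §2 Lemma B1 (multi-geometric series) and Lemma B (a level matching dominates every trace) -/

/-- **LEMMA B1: multi-geometric series over a finite index type.** -/
theorem hasSum_pi_geometric {Q : Type} [Fintype Q] (x : Q → ℝ) (hx0 : ∀ q, 0 ≤ x q) (hx1 : ∀ q, x q < 1) :
    HasSum (fun g : Q → ℕ => ∏ q, x q ^ g q) (∏ q, (1 - x q)⁻¹) := by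
  classical
  set a : ℝ := ∏ q, (1 - x q)⁻¹ with ha
  set F : ℕ → ℝ := fun N => ∏ q, ∑ n ∈ Finset.range N, x q ^ n with hF
  have hterm_nn : ∀ g : Q → ℕ, 0 ≤ ∏ q, x q ^ g q := fun g => Finset.prod_nonneg fun q _ => pow_nonneg (hx0 q) _
  have hbox : ∀ N, ∑ g ∈ Fintype.piFinset (fun _ : Q => Finset.range N), ∏ q, x q ^ g q = F N :=
    fun N => Finset.sum_prod_piFinset (Finset.range N) (fun q n => x q ^ n)
  have hgeom : ∀ q, HasSum (fun n : ℕ => x q ^ n) (1 - x q)⁻¹ :=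
    fun q => hasSum_geometric_of_lt_one (hx0 q) (hx1 q)
  have hfac_le : ∀ q N, ∑ n ∈ Finset.range N, x q ^ n ≤ (1 - x q)⁻¹ :=
    fun q N => sum_le_hasSum (Finset.range N) (fun n _ => pow_nonneg (hx0 q) n) (hgeom q)
  have hfac_nn : ∀ q N, 0 ≤ ∑ n ∈ Finset.range N, x q ^ n :=
    fun q N => Finset.sum_nonneg fun n _ => pow_nonneg (hx0 q) n
  have hF_le : ∀ N, F N ≤ a := fun N => Finset.prod_le_prod (fun q _ => hfac_nn q N) (fun q _ => hfac_le q N)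
  have hF_tend : Tendsto F atTop (𝓝 a) :=
    tendsto_finsetProd Finset.univ (fun q _ => (hgeom q).tendsto_sum_nat)
  have hsub : ∀ S : Finset (Q → ℕ), ∃ N, S ⊆ Fintype.piFinset (fun _ : Q => Finset.range N) := by
    intro S
    refine ⟨(S.sup fun g => Finset.univ.sup g) + 1, fun g hg => ?_⟩
    rw [Fintype.mem_piFinset]
    intro q
    rw [Finset.mem_range]
    have h1 : g q ≤ Finset.univ.sup g := Finset.le_sup (f := g) (Finset.mem_univ q)
    have h2 : Finset.univ.sup g ≤ S.sup fun g => Finset.univ.sup g :=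
      Finset.le_sup (f := fun g : Q → ℕ => Finset.univ.sup g) hg
    omega
  have hpart_le : ∀ S : Finset (Q → ℕ), ∑ g ∈ S, ∏ q, x q ^ g q ≤ a := by
    intro S
    obtain ⟨N, hN⟩ := hsub S
    calc ∑ g ∈ S, ∏ q, x q ^ g q ≤ ∑ g ∈ Fintype.piFinset (fun _ : Q => Finset.range N), ∏ q, x q ^ g q :=
          Finset.sum_le_sum_of_subset_of_nonneg hN fun g _ _ => hterm_nn g
      _ = F N := hbox N
      _ ≤ a := hF_le N
  refine hasSum_of_isLUB_of_nonneg a hterm_nn ⟨?_, ?_⟩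
  · rintro _ ⟨S, rfl⟩
    exact hpart_le S
  · intro b hb
    have hFb : ∀ N, F N ≤ b := fun N => by
      have := hb (Set.mem_range_self (Fintype.piFinset (fun _ : Q => Finset.range N)))
      rw [← hbox N]
      exact this
    exact le_of_tendsto' hF_tend hFb

/-- **LEMMA B1a: the free tower IS the multi-geometric series.** -/
theorem hasSum_occupation (d : ℕ) {m : ℝ} (hm : 0 < m) (c : ℝ) (L : ℕ) {s : ℝ} (hs : 0 < s) :
    HasSum (fun g : (Fin d × (Fin 3 → Fin L) → ℕ) => Real.exp (-(s * occupationEnergy d m c L g)))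
      ((∏ k : Fin 3 → Fin L, (1 - Real.exp (-(s * latticeDispersion m c L k)))⁻¹) ^ d) := by
  classical
  have key := hasSum_pi_geometric (Q := Fin d × (Fin 3 → Fin L))
    (fun p => Real.exp (-(s * latticeDispersion m c L p.2)))
    (fun p => (Real.exp_pos _).le)
    (fun p => by
      have hω : 0 < s * latticeDispersion m c L p.2 :=
        mul_pos hs (hm.trans_le (mass_le_latticeDispersion hm.le c L p.2))
      have : -(s * latticeDispersion m c L p.2) < 0 := by linarith
      exact lt_of_lt_of_eq (Real.exp_lt_exp.2 this) Real.exp_zero)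
  have h1 : (fun g : (Fin d × (Fin 3 → Fin L) → ℕ) => Real.exp (-(s * occupationEnergy d m c L g)))
      = fun g => ∏ p, Real.exp (-(s * latticeDispersion m c L p.2)) ^ g p := by
    funext g
    unfold occupationEnergy
    rw [Finset.mul_sum, ← Finset.sum_neg_distrib, Real.exp_sum]
    refine Finset.prod_congr rfl fun p _ => ?_
    rw [← Real.exp_nat_mul]
    congr 1
    ring
  have h2 : (∏ p : Fin d × (Fin 3 → Fin L), (1 - Real.exp (-(s * latticeDispersion m c L p.2)))⁻¹)
      = (∏ k : Fin 3 → Fin L, (1 - Real.exp (-(s * latticeDispersion m c L k)))⁻¹) ^ d := by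
    rw [Fintype.prod_prod_type]
    simp only [Finset.prod_const, Finset.card_univ, Fintype.card_fin]
  rw [h1, ← h2]
  exact key

/-- **LEMMA B (spectral bookkeeping, KERNEL): a level matching dominates every trace.** -/
theorem traceExcess_le_gaussTowerExcess_of_levelMatched
    {G : Type} [Group G] [TopologicalSpace G] [IsTopologicalGroup G] [CompactSpace G] [MeasurableSpace G] [BorelSpace G]
    {n : ℕ} {ρ : G →* Matrix (Fin n) (Fin n) ℂ} {β : ℝ} {L : ℕ} [NeZero L]
    {ι : Type} [DecidableEq ι] {rr : ι → ℝ} {i₀ : ι} (hd : IsRatioDatum ρ β L ι rr i₀)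
    {d : ℕ} {m c : ℝ} (hm : 0 < m) (hmatch : LevelMatched rr d m c L) (t : ℕ) :
    traceExcess ρ β L (t + 2) ≤ gaussTowerExcess d m c L (t + 2) := by
  classical
  obtain ⟨hr, h1, hsum⟩ := hd
  obtain ⟨f, hinj, hle⟩ := hmatch
  set s : ℝ := ((t + 2 : ℕ) : ℝ) with hsdef
  have hs : 0 < s := by rw [hsdef]; positivity
  set w : (Fin d × (Fin 3 → Fin L) → ℕ) → ℝ := fun g => Real.exp (-(s * occupationEnergy d m c L g)) with hwdef
  set P : ℝ := (∏ k : Fin 3 → Fin L, (1 - Real.exp (-(s * latticeDispersion m c L k)))⁻¹) ^ d with hPdef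
  have hw : HasSum w P := hasSum_occupation d hm c L hs
  have hw0 : w 0 = 1 := by
    simp [hwdef, occupationEnergy]
  set w' : (Fin d × (Fin 3 → Fin L) → ℕ) → ℝ := fun g => if g = 0 then 0 else w g with hw'def
  have hw' : HasSum w' (P - 1) := by
    have := hasSum_ite_sub_hasSum hw 0
    rw [hw0] at this
    exact this
  have hw'nn : ∀ g, 0 ≤ w' g := by
    intro g; simp only [hw'def]; split_ifs
    · exact le_rfl
    · exact (Real.exp_pos _).le
  have hfi0 : f i₀ = 0 := by
    by_contra hne
    have hE : m ≤ occupationEnergy d m c L (f i₀) := mass_le_occupationEnergy d hm.le c L hne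
    have h2 := hle i₀
    rw [h1] at h2
    have : Real.exp (-(occupationEnergy d m c L (f i₀))) < 1 := by
      rw [← Real.exp_zero]; exact Real.exp_lt_exp.2 (by linarith)
    linarith
  set u : ι → ℝ := Function.update (fun i => rr i ^ (t + 2)) i₀ 0 with hudef
  have hu : HasSum u (traceExcess ρ β L (t + 2)) := hsum t
  set S : Set ι := {i | rr i ≠ 0} with hSdef
  have hi0S : i₀ ∈ S := by simp [hSdef, h1]
  have hfS : ∀ i ∈ S, i ≠ i₀ → f i ≠ 0 := by
    intro i hi hne hfi
    exact hne (hinj hi hi0S (hfi.trans hfi0.symm))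
  have hle' : ∀ i : S, u i ≤ w' (f i) := by
    rintro ⟨i, hi⟩
    by_cases hii : i = i₀
    · subst hii
      simp [hudef, hfi0, hw'def]
    · have hfi : f i ≠ 0 := hfS i hi hii
      simp only [hudef, Function.update_of_ne hii, hw'def, if_neg hfi, hwdef]
      have h3 : rr i ^ (t + 2) ≤ Real.exp (-(occupationEnergy d m c L (f i))) ^ (t + 2) :=
        pow_le_pow_left₀ (hr i).1 (hle i) _
      have h4 : Real.exp (-(occupationEnergy d m c L (f i))) ^ (t + 2) =
          Real.exp (-(s * occupationEnergy d m c L (f i))) := by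
        rw [← Real.exp_nat_mul, hsdef]; ring_nf
      linarith [h3, h4.le]
  have huS : ∀ i, i ∉ S → u i = 0 := by
    intro i hi
    have hri : rr i = 0 := by simpa [hSdef] using hi
    by_cases hii : i = i₀
    · subst hii; simp [hudef]
    · simp [hudef, Function.update_of_ne hii, hri]
  have hu_ind : S.indicator u = u := by
    funext i
    by_cases hi : i ∈ S
    · simp [Set.indicator_of_mem hi]
    · simp [Set.indicator_of_notMem hi, huS i hi]
  have hsumS : ∑' i : S, u i = traceExcess ρ β L (t + 2) := by
    rw [tsum_subtype S u, hu_ind, hu.tsum_eq]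
  have hinj' : Function.Injective (fun i : S => f i) := by
    rintro ⟨i, hi⟩ ⟨j, hj⟩ hij
    exact Subtype.ext (hinj hi hj hij)
  have hsw' : Summable (fun i : S => w' (f i)) := hw'.summable.comp_injective hinj'
  have hsu : Summable (fun i : S => u i) := hu.summable.subtype S
  have step1 : ∑' i : S, u i ≤ ∑' i : S, w' (f i) := hsu.tsum_le_tsum hle' hsw'
  have step2 : ∑' i : S, w' (f i) ≤ ∑' g, w' g :=
    tsum_comp_le_tsum_of_inj hw'.summable hw'nn hinj'
  have step3 : ∑' g, w' g = P - 1 := hw'.tsum_eq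
  have hgoal : traceExcess ρ β L (t + 2) ≤ P - 1 := by
    rw [← hsumS]; linarith [step1, step2, step3.le, step3.ge]
  have hP : gaussTowerExcess d m c L (t + 2) = P - 1 := by
    simp only [gaussTowerExcess, hPdef, hsdef]
  rw [hP]; exact hgoal

/-! ## §2b The (v)/BC5-side negative: degenerate top levels admit no level matching -/

/-- **No level matching under a degenerate vacuum.**  If a family of ratios has TWO distinct indices at the top value `1`
(degenerate flux vacua — the `π₁(G) ≠ 1` ∕ twisted-sector situation, or the frozen finite-group limit), then it is NOT
level-matched into any free tower of positive mass `m`: both indices would have to sit on the empty occupation.  This is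
why `LevelwiseDominatedCofinal` is typed for simply-connected `G` only. -/
theorem not_levelMatched_of_two_tops {ι : Type} {rr : ι → ℝ} {i j : ι} (hij : i ≠ j) (hi : rr i = 1) (hj : rr j = 1)
    (d : ℕ) {m : ℝ} (hm : 0 < m) (c : ℝ) (L : ℕ) : ¬ LevelMatched rr d m c L := by
  rintro ⟨f, hinj, hle⟩
  have hzero : ∀ k, rr k = 1 → f k = 0 := by
    intro k hk
    by_contra hne
    have hE : m ≤ occupationEnergy d m c L (f k) := mass_le_occupationEnergy d hm.le c L hne
    have h2 := hle k
    rw [hk] at h2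
    have : Real.exp (-(occupationEnergy d m c L (f k))) < 1 := by
      rw [← Real.exp_zero]; exact Real.exp_lt_exp.2 (by linarith)
    linarith
  have hiS : i ∈ {k | rr k ≠ 0} := by simp [hi]
  have hjS : j ∈ {k | rr k ≠ 0} := by simp [hj]
  exact hij (hinj hiS hjS ((hzero i hi).trans (hzero j hj).symm))


/-! ## §3 Compositions BY NAME: LW-DOM ⇒ PXcof(1∕24) ⇒ (with N_cof) `IRcof` -/

/-- **LW-DOM ⇒ PXcof(1/24)** (KERNEL, sorry-free). -/
theorem pinnedExitsCofinal_of_levelwise (h : LevelwiseDominatedCofinal) :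
    PinnedExitsCofinalAt (1 / 24) := by
  intro G _ _ _ _ hG hsc
  letI : MeasurableSpace G := borel G
  haveI : BorelSpace G := ⟨rfl⟩
  intro r a ha ha0 hlb
  obtain ⟨d, c, μ, T₀, hc, hμ, hdom⟩ := h G hG hsc r a ha ha0 hlb
  obtain ⟨A, hA⟩ := gaussTowerExcess_small d c hc (1 / 48) (by norm_num)
  set T : ℝ := max T₀ (7 * |A| / μ) with hTdef
  refine ⟨2 * T, fun β₁ => ?_⟩
  obtain ⟨β, hβ₁, hβ0, L, instL, hL8, hTle, hleT, hlw⟩ := hdom T (le_max_left _ _) β₁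
  refine ⟨β, hβ₁, L, hL8, hleT, ?_⟩
  have haβ : 0 < a β := ha β
  haveI : NeZero L := instL
  haveI : SecondCountableTopology G :=
    (r.continuous.isClosedEmbedding r.injective).isEmbedding.secondCountableTopology
  obtain ⟨ι, hdec, rr, i₀, hrd⟩ := exists_ratioDatum r hβ0 L
  have hL4 : ((L : ℝ) - 3) / 4 ≤ ((L / 4 : ℕ) : ℝ) := by
    have h1 : L ≤ 4 * (L / 4) + 3 := by omega
    have h2 : (L : ℝ) ≤ 4 * ((L / 4 : ℕ) : ℝ) + 3 := by exact_mod_cast h1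
    linarith
  have hL8r : (8 : ℝ) ≤ L := by exact_mod_cast hL8
  have hT7 : 7 * |A| / μ ≤ T := le_max_right _ _
  have h7 : 7 * |A| ≤ μ * T := by rw [div_le_iff₀ hμ] at hT7; linarith
  have hmt : A ≤ μ * a β * ((L / 4 : ℕ) : ℝ) := by
    have s1 : μ * a β * (((L : ℝ) - 3) / 4) ≤ μ * a β * ((L / 4 : ℕ) : ℝ) :=
      mul_le_mul_of_nonneg_left hL4 (by positivity)
    have s2 : 5 * (a β * (L : ℝ)) / 32 ≤ a β * (((L : ℝ) - 3) / 4) := by nlinarith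
    have s3 : μ * (5 * (a β * (L : ℝ)) / 32) ≤ μ * (a β * (((L : ℝ) - 3) / 4)) :=
      mul_le_mul_of_nonneg_left s2 hμ.le
    have s4 : μ * (5 * T / 32) ≤ μ * (5 * (a β * (L : ℝ)) / 32) :=
      mul_le_mul_of_nonneg_left (by linarith) hμ.le
    have s5 : A ≤ |A| := le_abs_self A
    nlinarith [s1, s3, s4, s5, h7, abs_nonneg A]
  have hm : 0 < μ * a β := mul_pos hμ haβ
  have htower : gaussTowerExcess d (μ * a β) c L (L / 4 - 2 + 2) ≤ 1 / 48 := by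
    have hL4m : L / 4 - 2 + 2 = L / 4 := by omega
    rw [hL4m]
    exact hA L (μ * a β) hL8 (by positivity) hmt
  have hx := traceExcess_le_gaussTowerExcess_of_levelMatched hrd hm (hlw ι rr i₀ hrd) (L / 4 - 2)
  have h2 := one_sub_ratio_le_two_mul_traceExcess r hβ0 L (L / 4 - 2)
  show 1 - wilsonFinTorusPartition r.ρ β L L L (2 * (L / 4)) /
           wilsonFinTorusPartition r.ρ β L L L (L / 4) ^ 2 ≤ 1 / 24
  have hL4eq : (L / 4 - 2 + 2 : ℕ) = L / 4 := by omega
  simp only [hL4eq] at h2 hx htower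
  linarith [h2, hx, htower]

/-- **The slot's bill over the Theorems copy of PXcof: `PXcof(1∕24) → N_cof → IRcof`** (the composition `PinnedCofinalBill.IRcof_of`
of the registered skeleton `Cruxes/IRcof/Lines/pinned_cofinal_bill.lean` d3255819134117aa, restated over
`RunningLandmark.PinnedExitsCofinalAt` so that Theorems files can import it).  Simply-connected `G`: the landed X-free cofinal
kernel `PinnedExitCofinal.cofinalGapOn_of_pinnedExits`; `π₁(G) ≠ 1`: `IRnscCof` is that conjunct verbatim. -/
theorem IRcof_of_pinnedExitsCofinalAt (hP : PinnedExitsCofinalAt (1 / 24)) (hN : IRnscCof) :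
    Summit.QuantumFields.YangMills.Theses.BalabanLadder.IRcof := by
  intro G _ _ _ _ hG
  letI : MeasurableSpace G := borel G
  haveI : BorelSpace G := ⟨rfl⟩
  intro r a ha ha0 hlb
  by_cases hsc : SimplyConnectedSpace G
  · obtain ⟨T, hcof⟩ := hP G hG hsc r a ha ha0 hlb
    exact cofinalGapOn_of_pinnedExits r a ha ha0 hcof
  · exact hN G hG hsc r a ha ha0 hlb

/-- **Supplier arrow of the line «lipschitz-vacuum-transport»: `LW-DOM → N_cof → IRcof`** — any proof of
`LevelwiseDominatedCofinal` closes the registered stub `stub_pinnedExitsCofinal` of the slot and, with `N_cof`, the crux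
`IRcof` (stmt-QuantumFields-26930) BY NAME.  Conditional composition; neither hypothesis is proved anywhere. -/
theorem IRcof_of_levelwise (hLW : LevelwiseDominatedCofinal) (hN : IRnscCof) :
    Summit.QuantumFields.YangMills.Theses.BalabanLadder.IRcof :=
  IRcof_of_pinnedExitsCofinalAt (pinnedExitsCofinal_of_levelwise hLW) hN

end Summit.QuantumFields.YangMills.Cruxes.IR.LevelwiseDomination

end
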